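import Literature.Computability.Complexity.NTIMEPadding
import HarnessLib

/-!
# A total verifier for `NTIME(2ⁿ)` languages (window normal form)

Literature / complexity toolkit (serves the easy-witness decomposition, `EasyWitnessUniversal.lean`:
the universal language for `NTIME(2ⁿ)` inside `NEXP`). The tree's `NTIME t`
(`Nondeterministic.lean`) is in verifier form with a WINDOW: the machine `M` of a presentation
`(c, R, M)` of `L ∈ NTIME(2ⁿ)` is specified — value `R x y` and time `c · 2ⁿ + c` — only on pairs
`⟨x, y⟩` whose witness is admissible, `|y| ≤ c · 2ⁿ + c`; on longer witnesses `M` may do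
anything. A universal machine that simulates `M` under its own, larger clock therefore needs `M`
replaced first by a verifier that is specified on EVERY pair. This file provides that normal form,
by the device of `NTIMEPadding.lean` (there used for padding): cut the witness at exactly the
admissible length with the truncating wrapper `truncMapAux` (`TruncMapMachine.lean`) fed by the
exponential clock `expClock c 1 : x ↦ ⟨x, 1^{c·2ⁿ+c}⟩` (`exists_timeComputable_expClock`), reading
the discarded part two symbols per step, then run `M`:

* `exists_total_verifier_of_mem_NTIME_two_pow` — for `L ∈ NTIME(2ⁿ)` there are `C`, a total
  relation `R` and a machine `V` with (i) `V` outputs `[R x y]` on EVERY `⟨x, y⟩` within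
  `C · 2^{|x|} + C + |y|` steps, (ii) `x ∈ L ↔ ∃ y, |y| ≤ C · 2^{|x|} + C ∧ R x y`, and
  (iii) `R x y → x ∈ L` for every `y` whatsoever (`R x y = R₀ x (y ↾ (c·2ⁿ+c))`).

This is the form in which "the `i`th nondeterministic `2ⁿ`-time machine" enters a clocked
universal simulation (Arora–Barak 2009, §2.1.2 / Exercise 2.6; Impagliazzo–Kabanets–Wigderson
2002, proof of Lemma 5).

## References

* S. Arora, B. Barak, *Computational Complexity: A Modern Approach*, CUP 2009, Def. 2.1 and
  §2.1.2 (verifier form of nondeterministic time), §1.3 (several operations per step).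
* R. Impagliazzo, V. Kabanets, A. Wigderson, *In search of an easy witness*, JCSS 65 (2002),
  proof of Lemma 5 (the universal machine `U` for `NTIME(2ⁿ)`).
-/

namespace Literature.Computability.Complexity

open _root_.Computability Turing

/-- **Total verifier for an `NTIME(2ⁿ)` language.** From a presentation `(c, R₀, M)` of
`L ∈ NTIME(2ⁿ)` (specified only on admissible witnesses `|y| ≤ c·2ⁿ + c`) one gets a constant
`C`, the total relation `R x y = R₀ x (y ↾ (c·2ⁿ+c))` and the machine
`V = truncMapAux (clock of expClock c 1) ∘ M` such that: `V` outputs `[R x y]` on every pair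
`⟨x, y⟩` within `C·2^{|x|} + C + |y|` steps; `x ∈ L ↔ ∃ y, |y| ≤ C·2^{|x|} + C ∧ R x y`; and
`R x y → x ∈ L` for all `y`. (Arora–Barak: the verifier "ignores"/cuts the excess certificate;
the machine content is `outputsWithin_truncMapAux_boolPair`.) [cite: AroraBarak2009, §2.1.2] -/
theorem exists_total_verifier_of_mem_NTIME_two_pow {L : Language Bool}
    (hL : L ∈ NTIME (fun n => 2 ^ n)) :
    ∃ (C : ℕ) (R : List Bool → List Bool → Bool) (V : TM2ComputableAux Bool Bool),
      (∀ x y : List Bool, V.OutputsWithin (boolPair x y) (encodeBool (R x y))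
          (C * 2 ^ x.length + C + y.length)) ∧
      (∀ x : List Bool, x ∈ L ↔
          ∃ y : List Bool, y.length ≤ C * 2 ^ x.length + C ∧ R x y = true) ∧
      ∀ x y : List Bool, R x y = true → x ∈ L := by
  obtain ⟨c, R₀, M, hM, hLR⟩ := hL
  obtain ⟨C₁, Ck, hCk⟩ := exists_timeComputable_expClock c (k := 1) le_rfl
  -- the verifier: cut the witness at the admissible length, then run `M`
  let V : TM2ComputableAux Bool Bool := (truncMapAux Ck).comp M
  let W : List Bool → ℕ := fun x => c * 2 ^ x.length + c
  refine ⟨C₁ + 4 * c + 16, fun x y => R₀ x (y.take (W x)), V, fun x y => ?_, fun x => ?_,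
    fun x y h => ?_⟩
  · -- running time on an arbitrary pair
    have hclock : Ck.OutputsWithin x (expClock c 1 x) (C₁ * 2 ^ (x.length ^ 1) + C₁) := hCk x
    have h₁ := outputsWithin_truncMapAux_boolPair Ck (y := y) hclock
    simp only [List.length_replicate, pow_one] at h₁
    have hy' : (y.take (W x)).length ≤ c * 2 ^ x.length + c := List.length_take_le _ _
    have h₂ : M.OutputsWithin (boolPair x (y.take (W x)))
        (encodeBool (R₀ x (y.take (W x)))) (c * 2 ^ x.length + c) := hM x _ hy'
    have h := Turing.TM2ComputableAux.comp_outputsWithin _ _ h₁ h₂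
    refine h.mono ?_
    have hn : x.length ≤ 2 ^ x.length := Nat.lt_two_pow_self.le
    have hy2 : y.length / 2 ≤ y.length := Nat.div_le_self _ _
    have e1 : (C₁ + 4 * c + 16) * 2 ^ x.length =
        C₁ * 2 ^ x.length + 4 * (c * 2 ^ x.length) + 16 * 2 ^ x.length := by ring
    omega
  · -- the admissible witnesses are the same
    rw [hLR x]
    constructor
    · rintro ⟨y, hy, hR⟩
      have hy : y.length ≤ c * 2 ^ x.length + c := hy
      refine ⟨y, ?_, ?_⟩
      · have e1 : (C₁ + 4 * c + 16) * 2 ^ x.length =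
            C₁ * 2 ^ x.length + 4 * (c * 2 ^ x.length) + 16 * 2 ^ x.length := by ring
        omega
      · show R₀ x (y.take (W x)) = true
        rwa [List.take_of_length_le hy]
    · rintro ⟨y, -, hR⟩
      exact ⟨y.take (W x), List.length_take_le _ _, hR⟩
  · -- soundness for every witness
    rw [hLR x]
    exact ⟨y.take (W x), List.length_take_le _ _, h⟩

end Literature.Computability.Complexity
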